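import Summits.BirchSwinnertonDyer.BirchSwinnertonDyer.Theorems.ManinLocalTwoThreeEtaAsymptoticsTwentySeven
import Literature.NumberTheory.EllipticCurves.CuspFunctionDerivativeProofs
import HarnessLib

/-!
# A remainder calculus for `q`-asymptotics at `i∞`

Cell bsd-f2-manin, route `ManinLocalTwoThree`; toolkit for the three limits (T1)–(T3) of
`EtaIdentityReduction.abs_maninConstant_eq_one_twentySeven_of_tendsto` (fact-free `|c| = 1` on
`X₀(27)`).  For `f : ℍ → ℂ`, a polynomial `P ∈ ℂ[X]` and `m : ℕ` we work with the statement

  `(f(τ) − P(q)) / q^m → 0` at `i∞`,  `q = e^{2πiτ}`   ("`f = P(q) + o(q^m)`"),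

spelled out in every lemma (no definition is introduced).  We prove that it is closed under sums,
scalar multiples, products, powers, multiplication by `q^k`, inverses of non-vanishing functions
(`P(0) ≠ 0`), and reduction of `P` modulo `X^{m+1}`; that it yields `f → P(0)` and, for `P = 0`,
`f/q^k → 0` (`k ≤ m`); and — the analytic input — that it holds with `P = Σ_{n ≤ m} cₙ Xⁿ` for a
`1`-periodic holomorphic bounded `f` with `q`-series `Σ cₙ qⁿ` (`tendsto_of_hasSum`, via the tree's
`q`-expansion principle `qExpansion_one_coeff_eq_of_hasSum` and
`EtaAsymptotics.tendsto_div_qParam_pow_of_qExpansion_coeff_eq_zero`), in particular for the derivative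
`d/dτ φ = Σ 2πi n aₙ qⁿ` of a cusp function (`IsCuspFunction.hasSum_deriv`).
-/

set_option autoImplicit false

noncomputable section

open Complex Filter Topology Set Asymptotics Polynomial
open UpperHalfPlane hiding I
open scoped Real Topology Manifold MatrixGroups
open Literature.NumberTheory.EllipticCurves Literature.NumberTheory.EllipticCurves.ModularForms

namespace Summit.BirchSwinnertonDyer.BirchSwinnertonDyer.Theorems.ManinLocalTwoThree.QRemainder

/-! ## 1. Polynomial functions of `q` -/

/-- `q(τ) ≠ 0`. [folklore] -/
theorem qParam_ne_zero (τ : ℍ) : Function.Periodic.qParam 1 (τ : ℂ) ≠ 0 := by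
  simp [Function.Periodic.qParam, Complex.exp_ne_zero]

/-- `q → 0` at `i∞`. [folklore] -/
theorem tendsto_qParam : Tendsto (fun τ : ℍ ↦ Function.Periodic.qParam 1 (τ : ℂ)) atImInfty (𝓝 0) :=
  UpperHalfPlane.qParam_tendsto_atImInfty one_pos

/-- `τ ↦ F(q(τ))` is `1`-periodic (as a function on `ℂ` through `ofComplex`). [folklore] -/
theorem periodic_comp_qParam (F : ℂ → ℂ) :
    Function.Periodic ((fun τ : ℍ ↦ F (Function.Periodic.qParam 1 (τ : ℂ))) ∘ ofComplex) 1 := by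
  intro z
  by_cases hz : 0 < z.im
  · have hz' : 0 < (z + 1).im := by simpa using hz
    simp only [Function.comp_apply, ofComplex_apply_of_im_pos hz, ofComplex_apply_of_im_pos hz',
      UpperHalfPlane.coe_mk, qParam_one_add_one]
  · have h1 : z.im ≤ 0 := not_lt.mp hz
    have h2 : (z + 1).im ≤ 0 := by simpa using h1
    simp only [Function.comp_apply, ofComplex_apply_of_im_nonpos h1,
      ofComplex_apply_of_im_nonpos h2]

/-- `τ ↦ F(q(τ))` is holomorphic on `ℍ` for holomorphic `F`. [folklore] -/
theorem mdifferentiable_comp_qParam {F : ℂ → ℂ} (hF : Differentiable ℂ F) :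
    MDifferentiable 𝓘(ℂ) 𝓘(ℂ) (fun τ : ℍ ↦ F (Function.Periodic.qParam 1 (τ : ℂ))) := by
  rw [UpperHalfPlane.mdifferentiable_iff]
  refine ((hF.comp (Function.Periodic.differentiable_qParam (h := 1))).differentiableOn).congr
    fun z hz ↦ ?_
  simp [Function.comp_apply, ofComplex_apply_of_im_pos hz]

/-- `F(q(τ)) → F(0)` at `i∞` for continuous `F`. [folklore] -/
theorem tendsto_comp_qParam {F : ℂ → ℂ} (hF : Continuous F) :
    Tendsto (fun τ : ℍ ↦ F (Function.Periodic.qParam 1 (τ : ℂ))) atImInfty (𝓝 (F 0)) :=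
  (hF.tendsto 0).comp tendsto_qParam

/-- `τ ↦ F(q(τ))` is bounded at `i∞` for continuous `F`. [folklore] -/
theorem isBoundedAtImInfty_comp_qParam {F : ℂ → ℂ} (hF : Continuous F) :
    IsBoundedAtImInfty (fun τ : ℍ ↦ F (Function.Periodic.qParam 1 (τ : ℂ))) :=
  (tendsto_comp_qParam hF).isBigO_one ℝ

/-- `P(q(τ)) → P(0)` at `i∞`. [folklore] -/
theorem tendsto_eval_qParam (P : ℂ[X]) :
    Tendsto (fun τ : ℍ ↦ P.eval (Function.Periodic.qParam 1 (τ : ℂ))) atImInfty (𝓝 (P.eval 0)) :=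
  tendsto_comp_qParam (F := fun w ↦ P.eval w) P.continuous

/-! ## 2. The calculus of `(f − P(q))/q^m → 0` -/

/-- A polynomial function of `q` has remainder `0`. [folklore] -/
theorem tendsto_of_eq {f : ℍ → ℂ} {P : ℂ[X]} (m : ℕ)
    (h : ∀ τ : ℍ, f τ = P.eval (Function.Periodic.qParam 1 (τ : ℂ))) :
    Tendsto (fun τ : ℍ ↦ (f τ - P.eval (Function.Periodic.qParam 1 (τ : ℂ)))
      / Function.Periodic.qParam 1 (τ : ℂ) ^ m) atImInfty (𝓝 0) := by
  refine tendsto_const_nhds.congr fun τ ↦ ?_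
  rw [h τ, sub_self, zero_div]

/-- `f = P(q) + o(q^m)` implies `f → P(0)`. [folklore] -/
theorem tendsto_eval_zero {f : ℍ → ℂ} {P : ℂ[X]} {m : ℕ}
    (h : Tendsto (fun τ : ℍ ↦ (f τ - P.eval (Function.Periodic.qParam 1 (τ : ℂ)))
      / Function.Periodic.qParam 1 (τ : ℂ) ^ m) atImInfty (𝓝 0)) :
    Tendsto f atImInfty (𝓝 (P.eval 0)) := by
  have h2 := ((h.mul (tendsto_qParam.pow m)).add (tendsto_eval_qParam P))
  rw [zero_mul, zero_add] at h2
  refine h2.congr fun τ ↦ ?_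
  rw [div_mul_cancel₀ _ (pow_ne_zero m (qParam_ne_zero τ)), sub_add_cancel]

/-- Change of the polynomial by an equal one. [folklore] -/
theorem congr_poly {f : ℍ → ℂ} {P P' : ℂ[X]} {m : ℕ} (hP : P = P')
    (h : Tendsto (fun τ : ℍ ↦ (f τ - P.eval (Function.Periodic.qParam 1 (τ : ℂ)))
      / Function.Periodic.qParam 1 (τ : ℂ) ^ m) atImInfty (𝓝 0)) :
    Tendsto (fun τ : ℍ ↦ (f τ - P'.eval (Function.Periodic.qParam 1 (τ : ℂ)))
      / Function.Periodic.qParam 1 (τ : ℂ) ^ m) atImInfty (𝓝 0) := hP ▸ h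

/-- Change of the function by a pointwise equal one. [folklore] -/
theorem congr_fun {f g : ℍ → ℂ} {P : ℂ[X]} {m : ℕ} (hfg : ∀ τ : ℍ, f τ = g τ)
    (h : Tendsto (fun τ : ℍ ↦ (f τ - P.eval (Function.Periodic.qParam 1 (τ : ℂ)))
      / Function.Periodic.qParam 1 (τ : ℂ) ^ m) atImInfty (𝓝 0)) :
    Tendsto (fun τ : ℍ ↦ (g τ - P.eval (Function.Periodic.qParam 1 (τ : ℂ)))
      / Function.Periodic.qParam 1 (τ : ℂ) ^ m) atImInfty (𝓝 0) :=
  h.congr fun τ ↦ by rw [hfg τ]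

/-- **Reduction modulo `X^{m+1}`**: `P` may be replaced by `P'` if `P − P' = X^{m+1} S`. [folklore] -/
theorem reduce {f : ℍ → ℂ} {P : ℂ[X]} {m : ℕ} (P' S : ℂ[X]) (hS : P - P' = X ^ (m + 1) * S)
    (h : Tendsto (fun τ : ℍ ↦ (f τ - P.eval (Function.Periodic.qParam 1 (τ : ℂ)))
      / Function.Periodic.qParam 1 (τ : ℂ) ^ m) atImInfty (𝓝 0)) :
    Tendsto (fun τ : ℍ ↦ (f τ - P'.eval (Function.Periodic.qParam 1 (τ : ℂ)))
      / Function.Periodic.qParam 1 (τ : ℂ) ^ m) atImInfty (𝓝 0) := by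
  have h2 := h.add (tendsto_qParam.mul (tendsto_eval_qParam S))
  rw [zero_mul, add_zero] at h2
  refine h2.congr fun τ ↦ ?_
  have hq := qParam_ne_zero τ
  have hPP : P.eval (Function.Periodic.qParam 1 (τ : ℂ)) = P'.eval (Function.Periodic.qParam 1 (τ : ℂ))
      + Function.Periodic.qParam 1 (τ : ℂ) ^ (m + 1) * S.eval (Function.Periodic.qParam 1 (τ : ℂ)) := by
    have h3 := congrArg (eval (Function.Periodic.qParam 1 (τ : ℂ))) hS
    rw [eval_sub, eval_mul, eval_pow, eval_X] at h3
    linear_combination h3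
  rw [hPP]
  field_simp
  ring

/-- Sums. [folklore] -/
theorem add {f g : ℍ → ℂ} {P Q : ℂ[X]} {m : ℕ}
    (hf : Tendsto (fun τ : ℍ ↦ (f τ - P.eval (Function.Periodic.qParam 1 (τ : ℂ)))
      / Function.Periodic.qParam 1 (τ : ℂ) ^ m) atImInfty (𝓝 0))
    (hg : Tendsto (fun τ : ℍ ↦ (g τ - Q.eval (Function.Periodic.qParam 1 (τ : ℂ)))
      / Function.Periodic.qParam 1 (τ : ℂ) ^ m) atImInfty (𝓝 0)) :
    Tendsto (fun τ : ℍ ↦ (f τ + g τ - (P + Q).eval (Function.Periodic.qParam 1 (τ : ℂ)))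
      / Function.Periodic.qParam 1 (τ : ℂ) ^ m) atImInfty (𝓝 0) := by
  have h := hf.add hg
  rw [add_zero] at h
  refine h.congr fun τ ↦ ?_
  rw [eval_add]
  ring

/-- Differences. [folklore] -/
theorem sub {f g : ℍ → ℂ} {P Q : ℂ[X]} {m : ℕ}
    (hf : Tendsto (fun τ : ℍ ↦ (f τ - P.eval (Function.Periodic.qParam 1 (τ : ℂ)))
      / Function.Periodic.qParam 1 (τ : ℂ) ^ m) atImInfty (𝓝 0))
    (hg : Tendsto (fun τ : ℍ ↦ (g τ - Q.eval (Function.Periodic.qParam 1 (τ : ℂ)))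
      / Function.Periodic.qParam 1 (τ : ℂ) ^ m) atImInfty (𝓝 0)) :
    Tendsto (fun τ : ℍ ↦ (f τ - g τ - (P - Q).eval (Function.Periodic.qParam 1 (τ : ℂ)))
      / Function.Periodic.qParam 1 (τ : ℂ) ^ m) atImInfty (𝓝 0) := by
  have h := hf.sub hg
  rw [sub_zero] at h
  refine h.congr fun τ ↦ ?_
  rw [eval_sub]
  ring

/-- Scalar multiples. [folklore] -/
theorem const_mul {f : ℍ → ℂ} {P : ℂ[X]} {m : ℕ} (a : ℂ)
    (hf : Tendsto (fun τ : ℍ ↦ (f τ - P.eval (Function.Periodic.qParam 1 (τ : ℂ)))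
      / Function.Periodic.qParam 1 (τ : ℂ) ^ m) atImInfty (𝓝 0)) :
    Tendsto (fun τ : ℍ ↦ (a * f τ - (C a * P).eval (Function.Periodic.qParam 1 (τ : ℂ)))
      / Function.Periodic.qParam 1 (τ : ℂ) ^ m) atImInfty (𝓝 0) := by
  have h := hf.const_mul a
  rw [mul_zero] at h
  refine h.congr fun τ ↦ ?_
  rw [eval_mul, eval_C]
  ring

/-- **Products**: `f = P(q) + o(q^m)`, `g = Q(q) + o(q^m)` give `fg = (PQ)(q) + o(q^m)`. [folklore] -/
theorem mul {f g : ℍ → ℂ} {P Q : ℂ[X]} {m : ℕ}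
    (hf : Tendsto (fun τ : ℍ ↦ (f τ - P.eval (Function.Periodic.qParam 1 (τ : ℂ)))
      / Function.Periodic.qParam 1 (τ : ℂ) ^ m) atImInfty (𝓝 0))
    (hg : Tendsto (fun τ : ℍ ↦ (g τ - Q.eval (Function.Periodic.qParam 1 (τ : ℂ)))
      / Function.Periodic.qParam 1 (τ : ℂ) ^ m) atImInfty (𝓝 0)) :
    Tendsto (fun τ : ℍ ↦ (f τ * g τ - (P * Q).eval (Function.Periodic.qParam 1 (τ : ℂ)))
      / Function.Periodic.qParam 1 (τ : ℂ) ^ m) atImInfty (𝓝 0) := by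
  have h := (hf.mul (tendsto_eval_zero hg)).add ((tendsto_eval_qParam P).mul hg)
  rw [zero_mul, mul_zero, add_zero] at h
  refine h.congr fun τ ↦ ?_
  rw [eval_mul]
  ring

/-- Powers. [folklore] -/
theorem pow {f : ℍ → ℂ} {P : ℂ[X]} {m : ℕ}
    (hf : Tendsto (fun τ : ℍ ↦ (f τ - P.eval (Function.Periodic.qParam 1 (τ : ℂ)))
      / Function.Periodic.qParam 1 (τ : ℂ) ^ m) atImInfty (𝓝 0)) (n : ℕ) :
    Tendsto (fun τ : ℍ ↦ (f τ ^ n - (P ^ n).eval (Function.Periodic.qParam 1 (τ : ℂ)))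
      / Function.Periodic.qParam 1 (τ : ℂ) ^ m) atImInfty (𝓝 0) := by
  induction n with
  | zero => exact tendsto_of_eq m fun τ ↦ by simp
  | succ n ih =>
    have h := mul ih hf
    refine h.congr fun τ ↦ ?_
    rw [pow_succ, pow_succ]

/-- Multiplication by `q^k`. [folklore] -/
theorem qParam_pow_mul {f : ℍ → ℂ} {P : ℂ[X]} {m : ℕ} (k : ℕ)
    (hf : Tendsto (fun τ : ℍ ↦ (f τ - P.eval (Function.Periodic.qParam 1 (τ : ℂ)))
      / Function.Periodic.qParam 1 (τ : ℂ) ^ m) atImInfty (𝓝 0)) :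
    Tendsto (fun τ : ℍ ↦ (Function.Periodic.qParam 1 (τ : ℂ) ^ k * f τ
      - (X ^ k * P).eval (Function.Periodic.qParam 1 (τ : ℂ)))
      / Function.Periodic.qParam 1 (τ : ℂ) ^ m) atImInfty (𝓝 0) := by
  have h := mul (tendsto_of_eq (f := fun τ : ℍ ↦ Function.Periodic.qParam 1 (τ : ℂ) ^ k)
    (P := X ^ k) m (fun τ ↦ by rw [eval_pow, eval_X])) hf
  exact h

/-- **Inverses**: if `f = P(q) + o(q^m)` with `f` zero-free, `P(0) ≠ 0` and `PQ ≡ 1 (mod X^{m+1})`,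
then `f⁻¹ = Q(q) + o(q^m)`. [folklore] -/
theorem inv {f : ℍ → ℂ} {P : ℂ[X]} {m : ℕ} (Q S : ℂ[X]) (hPQ : P * Q - 1 = X ^ (m + 1) * S)
    (hf0 : ∀ τ : ℍ, f τ ≠ 0) (hP0 : P.eval 0 ≠ 0)
    (hf : Tendsto (fun τ : ℍ ↦ (f τ - P.eval (Function.Periodic.qParam 1 (τ : ℂ)))
      / Function.Periodic.qParam 1 (τ : ℂ) ^ m) atImInfty (𝓝 0)) :
    Tendsto (fun τ : ℍ ↦ ((f τ)⁻¹ - Q.eval (Function.Periodic.qParam 1 (τ : ℂ)))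
      / Function.Periodic.qParam 1 (τ : ℂ) ^ m) atImInfty (𝓝 0) := by
  -- `f Q(q) = 1 + o(q^m)`
  have h1 := reduce 1 S hPQ (mul hf (tendsto_of_eq (f := fun τ : ℍ ↦
    Q.eval (Function.Periodic.qParam 1 (τ : ℂ))) (P := Q) m (fun _ ↦ rfl)))
  -- multiply by `-f⁻¹ → -P(0)⁻¹`
  have h2 := h1.mul (((tendsto_eval_zero hf).inv₀ hP0).neg)
  rw [zero_mul] at h2
  refine h2.congr fun τ ↦ ?_
  have hq := pow_ne_zero m (qParam_ne_zero τ)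
  rw [eval_one]
  field_simp [hf0 τ]
  ring

/-- **Extraction**: `f = o(q^m)` gives `f/q^k → 0` for `k ≤ m`. [folklore] -/
theorem tendsto_div_pow {f : ℍ → ℂ} {m : ℕ} (k : ℕ) (hk : k ≤ m)
    (hf : Tendsto (fun τ : ℍ ↦ (f τ - (0 : ℂ[X]).eval (Function.Periodic.qParam 1 (τ : ℂ)))
      / Function.Periodic.qParam 1 (τ : ℂ) ^ m) atImInfty (𝓝 0)) :
    Tendsto (fun τ : ℍ ↦ f τ / Function.Periodic.qParam 1 (τ : ℂ) ^ k) atImInfty (𝓝 0) := by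
  have h := hf.mul (tendsto_qParam.pow (m - k))
  rw [zero_mul] at h
  refine h.congr fun τ ↦ ?_
  have hq := qParam_ne_zero τ
  rw [eval_zero, sub_zero, div_mul_eq_mul_div, div_eq_div_iff (pow_ne_zero m hq) (pow_ne_zero k hq),
    mul_assoc, ← pow_add, Nat.sub_add_cancel hk]

/-! ## 3. From `q`-series to remainders -/

/-- Removing finitely many terms from a `q`-series. [folklore] -/
theorem hasSum_sub_finset {c : ℕ → ℂ} {q a : ℂ} (s : Finset ℕ)
    (h : HasSum (fun n : ℕ ↦ c n • q ^ n) a) :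
    HasSum (fun n : ℕ ↦ (if n ∈ s then 0 else c n) • q ^ n) (a - ∑ n ∈ s, c n * q ^ n) := by
  have h1 : HasSum (fun n : ℕ ↦ if n ∈ s then c n * q ^ n else 0)
      (∑ n ∈ s, if n ∈ s then c n * q ^ n else 0) :=
    hasSum_sum_of_ne_finset_zero fun n hn ↦ if_neg hn
  rw [Finset.sum_congr rfl fun n hn ↦ if_pos hn] at h1
  refine (h.sub h1).congr_fun fun n ↦ ?_
  by_cases hn : n ∈ s <;> simp [hn]

/-- The polynomial function `τ ↦ Σ_{n ∈ s} cₙ q(τ)ⁿ` evaluates `Σ_{n ∈ s} C cₙ Xⁿ`. [folklore] -/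
theorem eval_sum_C_mul_X_pow (s : Finset ℕ) (c : ℕ → ℂ) (w : ℂ) :
    (∑ n ∈ s, C (c n) * X ^ n).eval w = ∑ n ∈ s, c n * w ^ n := by
  rw [eval_finsetSum]
  refine Finset.sum_congr rfl fun n _ ↦ ?_
  rw [eval_mul, eval_C, eval_pow, eval_X]

/-- **From a `q`-series to a remainder**: a `1`-periodic holomorphic function bounded at `i∞` with
`q`-series `Σ cₙ qⁿ` satisfies `f = Σ_{n ≤ m} cₙ qⁿ + o(q^m)` (the truncated `q`-series has vanishing
`q`-expansion coefficients up to `m`). [folklore] -/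
theorem tendsto_of_hasSum {f : ℍ → ℂ} {c : ℕ → ℂ}
    (hper : Function.Periodic (f ∘ ofComplex) 1) (hmd : MDifferentiable 𝓘(ℂ) 𝓘(ℂ) f)
    (hbd : IsBoundedAtImInfty f)
    (hf : ∀ τ : ℍ, HasSum (fun n : ℕ ↦ c n • Function.Periodic.qParam 1 (τ : ℂ) ^ n) (f τ)) (m : ℕ) :
    Tendsto (fun τ : ℍ ↦ (f τ - (∑ n ∈ Finset.range (m + 1), C (c n) * X ^ n).eval
      (Function.Periodic.qParam 1 (τ : ℂ))) / Function.Periodic.qParam 1 (τ : ℂ) ^ m) atImInfty (𝓝 0) := by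
  set s : Finset ℕ := Finset.range (m + 1) with hs
  -- the corrected function `g = f − Σ_{n ≤ m} cₙ qⁿ`
  set g : ℍ → ℂ := fun τ ↦ f τ - (∑ n ∈ s, C (c n) * X ^ n).eval (Function.Periodic.qParam 1 (τ : ℂ))
    with hg
  have hgper : Function.Periodic (g ∘ ofComplex) 1 := by
    have hP := periodic_comp_qParam fun w ↦ (∑ n ∈ s, C (c n) * X ^ n).eval w
    intro z
    have h1 := hper z
    have h2 := hP z
    simp only [Function.comp_apply] at h1 h2 ⊢
    simp only [hg]
    rw [h1, h2]
  have hgmd : MDifferentiable 𝓘(ℂ) 𝓘(ℂ) g :=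
    hmd.sub (mdifferentiable_comp_qParam (Polynomial.differentiable _))
  have hgbd : IsBoundedAtImInfty g := hbd.sub (isBoundedAtImInfty_comp_qParam (Polynomial.continuous _))
  have hgsum : ∀ τ : ℍ, HasSum (fun n : ℕ ↦ (if n ∈ s then 0 else c n) •
      Function.Periodic.qParam 1 (τ : ℂ) ^ n) (g τ) := fun τ ↦ by
    have h := hasSum_sub_finset s (hf τ)
    rwa [← eval_sum_C_mul_X_pow] at h
  have hcoeff : ∀ i ≤ m, (qExpansion 1 g).coeff i = 0 := fun i hi ↦ by
    rw [qExpansion_one_coeff_eq_of_hasSum hgper hgmd hgbd hgsum i, if_pos]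
    exact Finset.mem_range.mpr (Nat.lt_succ_of_le hi)
  exact EtaAsymptotics.tendsto_div_qParam_pow_of_qExpansion_coeff_eq_zero hgper hgmd hgbd hcoeff

/-- **The derivative of a cusp function**: for a cusp function `φ = Σ aₙ qⁿ` of period `1`,
`dφ/dτ = Σ_{n ≤ m} 2πi n aₙ qⁿ + o(q^m)`. [folklore] -/
theorem tendsto_deriv_of_isCuspFunction {φ : ℍ → ℂ} (hφ : IsCuspFunction 1 φ) (m : ℕ) :
    Tendsto (fun τ : ℍ ↦ (deriv (φ ∘ ofComplex) τ
      - (∑ n ∈ Finset.range (m + 1), C (2 * π * I * n * (qExpansion 1 φ).coeff n) * X ^ n).eval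
        (Function.Periodic.qParam 1 (τ : ℂ))) / Function.Periodic.qParam 1 (τ : ℂ) ^ m)
      atImInfty (𝓝 0) := by
  refine tendsto_of_hasSum hφ.periodic_deriv hφ.mdifferentiable_deriv hφ.isBoundedAtImInfty_deriv
    (fun τ ↦ ?_) m
  have h := hφ.hasSum_deriv τ
  simpa only [Complex.ofReal_one, div_one] using h

end Summit.BirchSwinnertonDyer.BirchSwinnertonDyer.Theorems.ManinLocalTwoThree.QRemainder

end
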